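import Summits.BirchSwinnertonDyer.Rank1Residual.X11b.ShapiroPairs
import HarnessLib

/-!
# BSD rank-≤1 residual cell, good SUPERSINGULAR reduction at `p = 3` with mod-3 image `3Nn` (normaliser of a NON-split Cartan,
# order 16, prime to 3) — family X8Three (class X8, `a_3 = ±3`, cell N6): `BSD(E,3)` per pair (`r_an = 0`, `3 ∤ #Ш_an`) from
# PUBLISHED theorems + ONE EXACT 3-descent certificate line — batch 05 (SUPPLEMENT 2 to batches 01–04 of GEN 18: the two N6
# rows `205555c1`, `477505b1` whose engine-1 runs of record j131308 / j131863 ended `ERROR: local image at v = 839 / 1949 not reached`)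

HONEST FRAMING (cell `b2b-bsdres-*`, verbatim): prove what is provable now; shrink each hard class to its core with data;
no claim beyond stated classes; COMBINATION classes deleted from PUBLISHED theorems only, CONSTRUCTION-shaped remainder
typed; this is not "finishing BSD". X8 stays CONSTRUCTION-SHAPED; everything here is PER PAIR; no lane verdict is changed;
no named fact; nothing is booked by this unit (OFFER — the owners / the lane / referee A decide). Unit
`b2b-bsdres-additive-p3` GEN 27 (prover-b2b-bsdres-additive-p3-g27-0; X8 prover B, CLASS-CLOSURE class lead N6·O3, X7
joint pair B side).

WHY THESE TWO ROWS NOW (class lead N6, gen 27; `class-closure/N6/WEEK-2026-08-28.md` §20): of N6's 70 `3Nn` cells GEN 18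
recorded 62 (`NonsplitCartanThreeDescentRecordsX8Three01–04`, p270139 p270155 p270170 p270696); 6 carry `3 ∣ #Ш_an`
(lower bound only); the last 2 — `205555c1 = 5·7²·839` and `477505b1 = 5·7²·1949` (the SAME octic algebra
`A = ℚ[x]/(ψ₃)`, `d_A = −257298363`) — failed on engine 1 ONLY because its random local-point sampler did not reach the
one-dimensional image `E(ℚ_v)/3E(ℚ_v)` at the large multiplicative prime `v ∈ {839, 1949}` (3 ∣ c_v: the non-identity
components are needed and a random integer x hits `x ≡ x_node (mod v)` with probability ≈ 1/v per try; harvest-1 GEN 27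
diagnosed the same mechanism on its T-full3 tails, `EFFICIENCY.md` §L.1). The ENGINE BYTES ARE UNCHANGED here: the curve
was simply re-run ALONE (a different position in the job's random stream) — `205555c1` certified EXACT `dim Sel³ = 0` in
4 of 6 single-curve re-runs (j167537 j167538 j167539 j167540; misses j167535 j167536), `477505b1` in 5 of 10 (j167541
j167542 j167543 j167549 j167550; misses j167544–j167548); every certified run agrees (same `S`, `Cl(A) = [1,[]]` certified,
16 generators 3-saturated, `dim H¹_S = 3`, `dim Sel³ = 0`). SECOND IMPLEMENTATION: unit `b2b-bsdres-x11c` GEN 15's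
`descentPlib.gp` FULL (Maschke) mode at `p = 3` in `R = ℚ(T′)` (degree 8), UNCHANGED: `477505b1` was already EXACT
`dim Sel³ = 0` in GEN 18's j131426; `205555c1` (INCOMPLETE there at `v = 839`, sampler budget) is EXACT `dim Sel³ = 0`,
`K_S = 0`, in j167553 with the kit's documented knob `JOB_MAXTRIES` raised 3 000 → 120 000 (bytes unchanged).

ENGINE CREDIT: unit `b2b-bsdres-x11b` (prover-b2b-bsdres-x11b-g4, -g6, -g8): the exact-element 3-descent `desc3lib.gp`
(Schaefer–Stoll in the octic étale algebra `A = ℚ[x]/(ψ₃)`, one Galois orbit on `E[3]∖0`; sha256 c4fb20b7…,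
BYTE-IDENTICAL) with its gen-8 driver `entry.gp` in EXACT mode (`bnfcertify(A,1) = 1` + 3-saturation of the S-units by
cubic characters; every listed Selmer element exact); unit `b2b-bsdres-x11c` GEN 15's kit wrapper (`main.py` 78a19635…,
`chunk_runner.py` 74b94fe3…, `entry.gp` 1efb1f5d…) — ALL FILES RUN UNCHANGED (kit copy
`HOME/b2b-bsdres-additive-p3/g18/desc3nnSS/kit_engine1_desc3nnSS/`, single-curve lists `HOME/b2b-bsdres-additive-p3/g27/nn3/`).

What enters the kernel per pair is ONE line: `hSel : #Sel^(3)(E/ℚ) = 3 ^ r_an` of the tree's class-free consumer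
`Typed.bsdp_of_card_selmerGroup_eq_pow_analyticRank` through x11c gen 12's `X11b.bsdp_of_ainvs_of_card_selmerGroup`
(GZK `hGZK`, `r_an ≤ 1`, `3 ∤ #Ш_an`; `Δ ≠ 0` by `decide`; NO image hypothesis, NO Tamagawa condition). Non-kernel inputs
per pair: `r_an = 0`, `#Ш_an = 1` (Cremona; the lane's values) and the certificate line. References: Schaefer–Stoll,
Trans. AMS 356 (2004) [SchaeferStoll2004]; Silverman, *AEC* X.1, X.4 [SilvermanAEC2009]; Miller, LMS JCM 14 (2011) §1
[Miller2011LMS]; Cremona [Cremona2006].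
-/

set_option autoImplicit false

noncomputable section

open scoped Classical

open WeierstrassCurve Literature.NumberTheory.EllipticCurves
  Literature.NumberTheory.EllipticCurves.Rank1Residual
  Literature.NumberTheory.EllipticCurves.Rank1Residual.Typed
  Literature.NumberTheory.EllipticCurves.Rank1Residual.X11RankOneCertificates
  Summit.BirchSwinnertonDyer.Rank1Residual.X11b

namespace Summit.BirchSwinnertonDyer.Rank1Residual.Supersingular

/-- **`BSD(E,3)` for `205555c1`** [EXACT] (cell N6, class X8: `N = 205555`, good supersingular at `3`, `a_3 = 3`; Cremona model `[0, 0, 1, -10049557, -6527809388]`; `ρ̄_{E,3}` = `3Nn`; rank `0`; `#Ш_an = 1`, `∏ c_ℓ = 54`)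
from GZK and the certificate line `#Sel^(3)(E/ℚ) = 3 ^ r_an`: EXACT 3-descent (x11b `desc3lib.gp` via x11c's GEN-15 kit, run UNCHANGED by additive-p3 GEN 27, kit j167537 — single-curve re-run; the same bytes certified it in 4 of 6 re-runs j167535–j167540, the other 2 reproducing GEN 18's sampler miss at `v = 839`):
octic algebra `A = ℚ[x]/(ψ₃)` with `|d_A| ≈ 10^8`, `S = {3, 5, 7, 839}`, `Cl(A) = [1, []]` CERTIFIED (`bnfcertify = 1`), `16` generators of `A(S,3)` (3-saturated by
cubic characters), `dim H¹(ℚ,E[3];S) = 3`, local images at every `ℓ ∈ S` reached, **`dim Sel^(3)(E/ℚ) = 0 = rank`** (analytic-rank step skipped, `JOB_SKIP_AR`: root number `+1`; `r_an = 0` is the lane's / Cremona's datum, binder `hr`) ⟹ **`#Sel^(3)(E/ℚ) = 3^0`**, mode `EXACT(bnfcertify1+3sat)`. Second implementation (x11c `descentPlib.gp` full mode `p = 3`, UNCHANGED, kit j167553 with `JOB_MAXTRIES` 3 000 → 120 000 — GEN 18's j131426 was INCOMPLETE at `v = 839`): dim Sel³ = 0 [EXACT, K_S 0, Cl(R) [1,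 []], local image at 839 complete] — AGREES. Kernel: `Δ ≠ 0`. Binders: `hGZK`, `r_an ≤ 1`, `#Ш_an` a `3`-unit, `hSel`.
[cite: Miller2011LMS, §1 and Def. 1.1] [cite: Cremona2006, Table 1 (Cremona label 205555c1)] -/
theorem bsdp3_nn205555c1 (hGZK : rank_eq_analyticRank_of_analyticRank_le_one)
    (W : WeierstrassCurve ℚ) (hW : W = ⟨0, 0, 1, -10049557, -6527809388⟩)
    (hr : W.analyticRank ≤ 1) {q : ℚ} (hq : shaAn W = (q : ℂ)) (hv : padicValRat 3 q = 0)
    (hSel : Nat.card (W.selmerGroup (3 : ℤ)) = 3 ^ W.analyticRank) : BSDp W 3 := by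
  subst hW
  haveI : Fact (Nat.Prime 3) := ⟨by norm_num⟩
  exact bsdp_of_ainvs_of_card_selmerGroup hGZK 0 0 1 (-10049557) (-6527809388) (by decide +kernel) 3 hr hq hv hSel

/-- **`BSD(E,3)` for `477505b1`** [EXACT] (cell N6, class X8: `N = 477505`, good supersingular at `3`, `a_3 = 3`; Cremona model `[1, -1, 0, -9991354, 12594954035]`; `ρ̄_{E,3}` = `3Nn`; rank `0`; `#Ш_an = 1`, `∏ c_ℓ = 36`)
from GZK and the certificate line `#Sel^(3)(E/ℚ) = 3 ^ r_an`: EXACT 3-descent (x11b `desc3lib.gp` via x11c's GEN-15 kit, run UNCHANGED by additive-p3 GEN 27, kit j167541 — single-curve re-run; the same bytes certified it in 5 of 10 re-runs j167541–j167550, the other 5 reproducing GEN 18's sampler miss at `v = 1949`):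
octic algebra `A = ℚ[x]/(ψ₃)` with `|d_A| ≈ 10^8`, `S = {3, 5, 7, 1949}`, `Cl(A) = [1, []]` CERTIFIED (`bnfcertify = 1`), `16` generators of `A(S,3)` (3-saturated by
cubic characters), `dim H¹(ℚ,E[3];S) = 3`, local images at every `ℓ ∈ S` reached, **`dim Sel^(3)(E/ℚ) = 0 = rank`** (analytic-rank step skipped, `JOB_SKIP_AR`: root number `+1`; `r_an = 0` is the lane's / Cremona's datum, binder `hr`) ⟹ **`#Sel^(3)(E/ℚ) = 3^0`**, mode `EXACT(bnfcertify1+3sat)`. Second implementation (x11c `descentPlib.gp` full mode `p = 3`, UNCHANGED, GEN 18 kit j131426): dim Sel³ = 0 [EXACT, K_S 0, Cl(R) [1, []]] — AGREES. Kernel: `Δ ≠ 0`. Binders: `hGZK`, `r_an ≤ 1`, `#Ш_an` a `3`-unit, `hSel`.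
[cite: Miller2011LMS, §1 and Def. 1.1] [cite: Cremona2006, Table 1 (Cremona label 477505b1)] -/
theorem bsdp3_nn477505b1 (hGZK : rank_eq_analyticRank_of_analyticRank_le_one)
    (W : WeierstrassCurve ℚ) (hW : W = ⟨1, -1, 0, -9991354, 12594954035⟩)
    (hr : W.analyticRank ≤ 1) {q : ℚ} (hq : shaAn W = (q : ℂ)) (hv : padicValRat 3 q = 0)
    (hSel : Nat.card (W.selmerGroup (3 : ℤ)) = 3 ^ W.analyticRank) : BSDp W 3 := by
  subst hW
  haveI : Fact (Nat.Prime 3) := ⟨by norm_num⟩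
  exact bsdp_of_ainvs_of_card_selmerGroup hGZK 1 (-1) 0 (-9991354) 12594954035 (by decide +kernel) 3 hr hq hv hSel

end Summit.BirchSwinnertonDyer.Rank1Residual.Supersingular

end
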